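import Summits.Ventures.HodgeRepro2.T6N41PlaceLCHyp
import Summits.Ventures.HodgeRepro2.T6N41PlaceSatakeMain

/-!
# T6N41PlaceLCMain — the compat field `BCχ_eq` as a theorem from the Langlands-class display (Tier 6, M2; proof lane; owner t6-p4)

`BCχ_eq_of_lc`: over the core `C : InertData Pl` and the Langlands-class carriers `L : LCDatum C`, from the
displays Getz–Hahn §7.5–7.6 (`Hyp.GetzHahn2024_Prop7_6_5`), Harris II (2.2.5)(b) and Rogawski §11.4 (core
forms): at every inert prime off `S`, `Pl.BCχ 𝔓 = twist (BCrog π_v) (ξV 𝔓)`.  Harris puts `π_v` in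
`JH(I(χ′/χ))` with `(χ′/χ)(ϖ) = −1` (F3); `π_v` is unramified (`π_unr`), so Getz–Hahn gives a conjugator `s` with
`lc π_v = s · rep (−1) · σ(s)⁻¹`; LR's definition on the class (`BC_lc`) gives `BC(π_v) ∈ {π(−1, (−1)⁻¹),
π((−1)⁻¹, −1)}` — one representation, `(−1)⁻¹ = −1`; Rogawski §11.4 gives `ρ̃ = π(−1, (−1)⁻¹)`; the twist by
`χ_V` (`BCχ_def`) on both sides closes.  Compared with `T6N41PlaceSatakeMain.BCχ_eq_of_satake`: no `sat`, no
`sat_spec`, no Rogawski §4.5 — the dictionary is the display.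

`inertDatum_of_lc`, `N41_placement_kappa_lc`: as in T6N41PlaceSatakeMain, over `LCDatum`.  `#print axioms` =
{propext, Classical.choice, Quot.sound}.

§8(d): uses an L-value-free non-vanishing device: NO.
-/

namespace Summit.Ventures.HodgeRepro2.T6
namespace N41Place

variable {ι : Type*} {D : DoublingLDatum ι} {Pl : PlacementDatum D}

/-- **The compat field `BCχ_eq` as a theorem, from the Langlands-class display.** -/
theorem BCχ_eq_of_lc (C : InertData Pl) (L : LCDatum C)
    (hGH : Hyp.GetzHahn2024_Prop7_6_5 L)
    (hHa : Hyp.HarrisII2007_Prop2_2_5_b_core C) (hRo : Hyp.Rogawski1990_Sec11_4_BC_core C) :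
    ∀ 𝔓, C.inert 𝔓 → Pl.b 𝔓 ∉ D.S → Pl.BCχ 𝔓 = C.twist 𝔓 (C.BCrog 𝔓 (C.π (Pl.b 𝔓))) (C.ξV 𝔓) := by
  intro 𝔓 hi hS
  -- F3: `(χ′/χ)(ϖ) = −1`
  have hχ : C.χHarris 𝔓 = -1 := C.χHarris_eq 𝔓 hi hS
  -- Harris: `π_v ∈ JH(I(χ′/χ))`
  have hmem : C.π (Pl.b 𝔓) ∈ C.JH 𝔓 (C.χHarris 𝔓) :=
    hHa 𝔓 hi hS (C.thetaLift_all _) (C.βTrivial_of 𝔓 hi hS)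
  -- Getz–Hahn: the Langlands class of the unramified `π_v` is the twisted class of `rep (χ′/χ)(ϖ)`
  obtain ⟨s, hs, hlc⟩ := hGH 𝔓 hi (C.χHarris 𝔓) (C.π (Pl.b 𝔓)) (L.π_unr 𝔓 hi hS) hmem
  -- LR's definition on the class: `BC(π_v) ∈ {π(a, a⁻¹), π(a⁻¹, a)}`, `a = −1`
  have hBC := L.BC_lc 𝔓 hi hS (C.χHarris 𝔓) s hs hlc
  -- Rogawski §11.4 on the unitary value `−1`
  have hunit : ‖((C.χHarris 𝔓 : ℂˣ) : ℂ)‖ = 1 := by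
    rw [hχ]
    simp
  have hRog : C.BCrog 𝔓 (C.π (Pl.b 𝔓)) = Pl.ps 𝔓 (C.χHarris 𝔓) (C.χHarris 𝔓)⁻¹ :=
    hRo 𝔓 hi (C.χHarris 𝔓) hunit _ hmem
  rw [L.BCχ_def 𝔓 hi, hRog, hχ]
  rw [hχ] at hBC
  have hinv : ((-1 : ℂˣ))⁻¹ = -1 := inv_neg_one
  rw [hinv] at hBC ⊢
  rcases hBC with h | h <;> rw [h]

/-- The inert datum over the core `C` whose compat field is the THEOREM `BCχ_eq_of_lc`. -/
def inertDatum_of_lc (C : InertData Pl) (L : LCDatum C) (hGH : Hyp.GetzHahn2024_Prop7_6_5 L)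
    (hHa : Hyp.HarrisII2007_Prop2_2_5_b_core C) (hRo : Hyp.Rogawski1990_Sec11_4_BC_core C) :
    InertDatum Pl :=
  C.toDatum (BCχ_eq_of_lc C L hGH hHa hRo)

/-- Harris II (2.2.5)(b) holds on `inertDatum_of_lc` (it is the core form). -/
theorem harris_of_lc (C : InertData Pl) (L : LCDatum C) (hGH : Hyp.GetzHahn2024_Prop7_6_5 L)
    (hHa : Hyp.HarrisII2007_Prop2_2_5_b_core C) (hRo : Hyp.Rogawski1990_Sec11_4_BC_core C) :
    Hyp.HarrisII2007_Prop2_2_5_b (inertDatum_of_lc C L hGH hHa hRo) := hHa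

/-- Rogawski §11.4 holds on `inertDatum_of_lc` (it is the core form). -/
theorem rogawski_of_lc (C : InertData Pl) (L : LCDatum C) (hGH : Hyp.GetzHahn2024_Prop7_6_5 L)
    (hHa : Hyp.HarrisII2007_Prop2_2_5_b_core C) (hRo : Hyp.Rogawski1990_Sec11_4_BC_core C) :
    Hyp.Rogawski1990_Sec11_4_BC (inertDatum_of_lc C L hGH hHa hRo) := hRo

/-- **The placement (P7) with κ, over the core and the Langlands-class carriers.**  `N41_placement_kappa` on
`inertDatum_of_lc`: binders = the core `C`, the carriers `L`, the split / Langlands-quotient / convention data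
over it, the EIGHT displays by name (Lapid–Rallis §7, Bump (5.22), Getz–Hahn §7.5–7.6, Harris II (2.2.5)(b),
Rogawski §11.4, Mínguez Thm 1 (2), Bump Thm 4.5.1, Rao Cor. A.5 (1)), the dichotomy `hdich` and the residual
`hκ'` — the compat field `BCχ_eq` is not among them. -/
theorem N41_placement_kappa_lc (D : DoublingLDatum ι) (Pl : PlacementDatum D)
    (C : InertData Pl) (L : LCDatum C) (hGH : Hyp.GetzHahn2024_Prop7_6_5 L)
    (hHa : Hyp.HarrisII2007_Prop2_2_5_b_core C) (hRo : Hyp.Rogawski1990_Sec11_4_BC_core C)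
    (Sp : SplitDatum (inertDatum_of_lc C L hGH hHa hRo)) (Lq : SplitLQ Sp) (Kd : KappaDatum Sp)
    (hLR7 : Hyp.LapidRallis2005_Sec7_Unramified D Pl) (hB : Hyp.Bump1997_5_22 Pl)
    (hM : Hyp.Minguez2008_Thm1_2_LQ Lq) (hB451 : Hyp.Bump1997_Thm4_5_1 Lq)
    (hRao : Hyp.Rao1993_CorA5_1 Kd)
    (hdich : ∀ 𝔓, Pl.b 𝔓 ∉ D.S → C.inert 𝔓 ∨ Sp.splitPlace (Pl.b 𝔓))
    -- [residual: AD — TIER5 §N4.1.10 Lemma A′-4 (b4)–(b6), the local convention identity `κ_v(ϖ_v) = κ′(ϖ_v)⁻¹`]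
    (hκ' : ∀ v, Sp.splitPlace v → v ∉ D.S → Kd.κv v = (Kd.κ' v)⁻¹) :
    ∀ v ∉ D.S, ∀ s : ℂ, D.Lv v s = D.g₁ v s * D.g₂ v s :=
  N41_placement_kappa D Pl (inertDatum_of_lc C L hGH hHa hRo) Sp Lq Kd hLR7 hB
    (harris_of_lc C L hGH hHa hRo) (rogawski_of_lc C L hGH hHa hRo) hM hB451 hRao hdich hκ'

end N41Place
end Summit.Ventures.HodgeRepro2.T6
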